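import Literature.NumberTheory.EllipticCurves.PastenHeightBoundsProofs
import Literature.NumberTheory.EllipticCurves.SilvermanHeightLogDiscriminantProofs
import Literature.NumberTheory.DiophantineGeometry.EllArithGlueProofs
import Literature.NumberTheory.DiophantineGeometry.MinimalDiscriminantFiniteProofs
import Literature.NumberTheory.DiophantineGeometry.MinimalDiscriminantProofs
import Literature.NumberTheory.Sieve.DivisorBound
import HarnessLib

/-!
# Pasten 2024, Thm 7.6 (the Shimura curve approach to `abc`, height bound) from Thm 6.1 and (3.4)

Companion proof file of `PastenHeightBounds` / `PastenHeightBoundsProofs` (named fact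
`pasten2024_height_lt` = H. Pasten, *Shimura curves and the abc conjecture*, J. Number Theory 254
(2024) 214–335 = arXiv:1705.09251, Thm 1.9). `PastenHeightBoundsProofs` reduces Thm 1.9 to
**Thm 7.6** (`h(E) < (1/2 + ε) log δ_{D,M}(E)` for `N ≫_ε 1`) and **Thm 7.2** over an abstract
degree function `δ` (`pasten2024_height_lt_of_thm_7_6_of_thm_7_2`). This file PROVES the printed
proof of the height half of Thm 7.6 (p. 27) from its two inputs, again over abstract degree
functions `δ₁ : WeierstrassCurve ℚ → ℝ` (for `δ_{1,N}(E)`, the degree of the optimal quotient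
`J₀(N) → A_{1,N}`) and `δ : WeierstrassCurve ℚ → ℕ → ℕ → ℝ` (for `δ_{D,M}(E)`, the degree of the
optimal quotient `J_0^D(M) → A_{D,M}`; Shimura curves are not in the tree yet — a definition
`ShimuraCurveIntegralForms` is in review for route ABC/RibetTakahashiSplit):

* `h34` = **(3.4)** (§3 p. 13, the classical modular approach): *"`h(E) ≤ ½ log δ_{1,N} + 9`"*
  (Frey's formula, the Manin constant, `log(2π c_f) + log ‖f‖ > −6`, Mazur–Kenku and Faltings'
  Lemma 5; `D = 1` material, not proved here);
* `h61` = **Thm 6.1, first display (EqUpperRT)** (p. 20, refined Ribet–Takahashi): *"Let `E` be an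
  elliptic curve over `ℚ` of conductor `N` and let `N = DM` be an admissible factorization. The
  numerator of `γ_{D,M,E}` is supported on primes `≤ 163` and it is bounded from above by
  `163^{ω(D)}`. In particular, we have
  `log δ_{1,N} ≤ log δ_{D,M} + log(∏_{p∣D} v_p(Δ_E)) + 5.1·ω(D)`"*, with `v_p(Δ_E)` the exponent of
  `p` in the minimal discriminant `|Δ_E| = W.minimalDiscriminantNorm ℤ` and `ω(D) = #D.primeFactors`;

and the conclusion is the height half of **Thm 7.6** (p. 27): *"Let `ε > 0`. For all elliptic curves
`E` of conductor `N ≫_ε 1` (with an effective implicit constant), and for any admissible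
factorization `N = DM` we have [...] `h(E) < (1/2 + ε) log δ_{D,M}(E)`"* — exactly the hypothesis
`h76` of `pasten2024_thm_7_7_of_thm_7_6_of_thm_7_2`. Composed with that theorem and the Cor 7.8
glue: `pasten2024_height_lt_of_eq_3_4_of_thm_6_1_of_thm_7_2` (Thm 1.9 from (3.4), Thm 6.1 and
Thm 7.2). The variants `pasten2024_thm_7_6_height_of_bounds` /
`pasten2024_height_lt_of_bounds_of_thm_7_2` allow arbitrary constants `A`, `B`, `B'` in place of
the printed `9`, `5.1`, `0` (same proof,
`thm76_real_core_general`), so that other renderings of `δ_{1,N}` (e.g. the minimal parametrisation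
degree of `E` itself, `≤ 163 δ_{1,N}`) can be plugged in.

**The printed proof (p. 27) and its transcription.** *"The classical modular approach gives upper
bounds for `h(E)` [...] in terms of `log δ_{1,N}` (cf. (3.2) and (3.4)). The result now follows from
the first (effective) inequality in Theorem 6.1, together with the estimates
`log ∏_{p∣D} v_p(Δ_E) ≤ log d(Δ_E) < 1.07 log|Δ_E| / log log|Δ_E| ≤ 1.07 (12 h(E) + 16)/log log N`
(by (3.2))."* We follow it with the divisor bound in the form `d(n) ≤ C_η n^η` (Hardy–Wright
Thm 315, `Sieve.exists_card_divisors_le_mul_rpow'`; the paper's `1.07/log log` (Nicolas–Robin) is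
only needed for explicit error terms): `∏_{p∣D} v_p(Δ_E) ≤ d(|Δ_E|) ≤ C |Δ_E|^η`,
`ω(D) ≤ ω(N) ≤ log₂ d(N) ≤ 2(log C + η log N)`, `log N ≤ log|Δ_E| ≤ 12 h(E) + 16` (**(3.2)**, the
PROVED `pasten2024_log_minimalDiscriminant_le_holds`, and `N ∣ Δ_min`,
`WeierstrassCurve.conductorNorm_dvd_minimalDiscriminantNorm`), so that
`h ≤ ½ log δ_{D,M} + 67.2 η h + K(η, C)`; with `η = θ/135`, `θ = ε/(1 + 2ε)` and
`log N ≥ (24/θ)(K + 1)` (which forces `h > 0` and `K ≤ (θ/2) h`) this gives `(1 − θ) h < ½ log δ_{D,M}`,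
i.e. `h < (1/2 + ε) log δ_{D,M}` (`thm76_real_core`, pure real arithmetic).

## References

* H. Pasten, *Shimura curves and the abc conjecture*, J. Number Theory 254 (2024) 214–335,
  arXiv:1705.09251: §3 (3.2), (3.4) (p. 13), Thm 6.1 (p. 20), Thm 7.6 and its proof, Thm 7.7,
  Cor 7.8 (p. 27). [`PastenShimura2024`]
* G. H. Hardy, E. M. Wright, *An Introduction to the Theory of Numbers*, Thm 315 (`d(n) ≪ n^η`).
* J. H. Silverman, *The Arithmetic of Elliptic Curves*, GTM 106, VIII.8, VIII.11 (`N ∣ Δ_min`).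
  [`SilvermanAEC2009`]
-/

noncomputable section

open WeierstrassCurve IsDedekindDomain Finset

namespace Literature.NumberTheory.EllipticCurves.ModularForms

/-! ### The real arithmetic of the proof of Thm 7.6 -/

/-- **The bookkeeping of the proof of Thm 7.6.** With `θ = ε/(1+2ε)`, `η = θ/135`,
`K = 5.6 c + 89.6 η + 9`: if `h ≤ ℓ/2 + X/2 + 2.55 w + 9` ((3.4) + Thm 6.1), `X ≤ c + η Λ`
(divisor bound for `∏ v_p`), `Λ ≤ 12 h + 16` ((3.2)), `w ≤ 2 (c + η n)` (`ω(D)`), `n ≤ Λ`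
(`N ∣ Δ`) and `n ≥ (24/θ)(K + 1)` (`N ≫ 1`), then `h < (1/2 + ε) ℓ`. [folklore] -/
theorem thm76_real_core {ε θ η c K h ℓ X Λ n w : ℝ} (hε : 0 < ε) (hθ : θ = ε / (1 + 2 * ε))
    (hη : η = θ / 135) (hc : 0 ≤ c) (hK : K = 5.6 * c + 89.6 * η + 9)
    (h1 : h ≤ ℓ / 2 + X / 2 + 2.55 * w + 9) (h2 : X ≤ c + η * Λ) (h3 : Λ ≤ 12 * h + 16)
    (h4 : w ≤ 2 * (c + η * n)) (h5 : n ≤ Λ) (h7 : 24 / θ * (K + 1) ≤ n) :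
    h < (1 / 2 + ε) * ℓ := by
  have hθpos : 0 < θ := by rw [hθ]; positivity
  have hθle : θ ≤ 1 / 2 := by
    rw [hθ, div_le_iff₀ (by positivity)]
    linarith
  have hη0 : 0 ≤ η := by rw [hη]; positivity
  -- Step A: `h ≤ ℓ/2 + 67.2 η h + K`
  have hA1 : η * Λ ≤ 12 * (η * h) + 16 * η := by
    nlinarith [mul_le_mul_of_nonneg_left h3 hη0]
  have hA2 : η * n ≤ 12 * (η * h) + 16 * η := by
    nlinarith [mul_le_mul_of_nonneg_left (h5.trans h3) hη0]
  have hA : h ≤ ℓ / 2 + 67.2 * (η * h) + K := by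
    rw [hK]; linarith
  -- Step B: largeness of `n` forces `h > 0` and absorbs `K`
  have hB1 : 24 * (K + 1) ≤ θ * n := by
    have := mul_le_mul_of_nonneg_left h7 hθpos.le
    have e : θ * (24 / θ * (K + 1)) = 24 * (K + 1) := by field_simp
    linarith
  have hB2 : θ * n ≤ 12 * (θ * h) + 16 * θ := by
    nlinarith [mul_le_mul_of_nonneg_left (h5.trans h3) hθpos.le]
  have hK9 : 9 ≤ K := by rw [hK]; nlinarith
  have hθh : 2 * (K + 1) - 4 / 3 * θ ≤ θ * h := by linarith
  have hh : 0 < h := by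
    have hpos : 0 < θ * h := by linarith
    exact pos_of_mul_pos_right hpos hθpos.le
  have hB3 : 67.2 * (η * h) ≤ 1 / 2 * (θ * h) := by
    rw [hη]
    have : 0 ≤ θ * h := by positivity
    nlinarith
  have hB4 : K ≤ 1 / 2 * (θ * h) - 1 / 3 := by linarith
  have hmain : h - θ * h < ℓ / 2 := by linarith
  -- Step C: `θ = ε/(1+2ε)`: `(1+2ε)(h − θ h) = h + ε h < (1+2ε) ℓ/2 = ℓ/2 + ε ℓ`
  have e : (1 + 2 * ε) * (θ * h) = ε * h := by
    rw [hθ]; field_simp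
  have hC1 := mul_lt_mul_of_pos_left hmain (by positivity : (0 : ℝ) < 1 + 2 * ε)
  have hC2 : h + ε * h < ℓ / 2 + ε * ℓ := by nlinarith [hC1, e]
  nlinarith [mul_pos hε hh]

/-! ### Elementary inputs: `∏_{p ∣ D} v_p(n) ≤ d(n)`, `2^{ω(n)} ≤ d(n)`, `ω(n) log 2 ≤ log C + η log n` -/

/-- `∏_{p ∈ s} v_p(n) ≤ d(n)` for `s ⊆ primeFactors n` (`d(n) = ∏_{p ∣ n} (v_p(n) + 1)`). [folklore] -/
private theorem prod_factorization_le_card_divisors {n : ℕ} (hn : n ≠ 0) {s : Finset ℕ}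
    (hs : s ⊆ n.primeFactors) : ∏ p ∈ s, n.factorization p ≤ n.divisors.card := by
  rw [Nat.card_divisors hn]
  calc ∏ p ∈ s, n.factorization p ≤ ∏ p ∈ s, (n.factorization p + 1) :=
        prod_le_prod' fun p _ ↦ Nat.le_succ _
    _ ≤ ∏ p ∈ n.primeFactors, (n.factorization p + 1) :=
        prod_le_prod_of_subset_of_one_le' hs fun p _ _ ↦ Nat.succ_pos _

/-- `2^{ω(n)} ≤ d(n)`. [folklore] -/
private theorem two_pow_card_primeFactors_le_card_divisors {n : ℕ} (hn : n ≠ 0) :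
    2 ^ n.primeFactors.card ≤ n.divisors.card := by
  rw [Nat.card_divisors hn, ← prod_const]
  exact prod_le_prod' fun p hp ↦ Nat.succ_le_succ
    ((Nat.prime_of_mem_primeFactors hp).factorization_pos_of_dvd hn (Nat.dvd_of_mem_primeFactors hp))

/-- From the divisor bound `d(n) ≤ C n^η` (`C ≥ 1`): `ω(n) ≤ 2 (log C + η log n)` for `n ≠ 0`
(`2^{ω(n)} ≤ d(n)`, `log 2 > 1/2`). [folklore] -/
private theorem card_primeFactors_le_of_divisorBound {C η : ℝ} (hC : 1 ≤ C) (hη : 0 ≤ η)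
    (hd : ∀ n : ℕ, (n.divisors.card : ℝ) ≤ C * (n : ℝ) ^ η) {n : ℕ} (hn : n ≠ 0) :
    (n.primeFactors.card : ℝ) ≤ 2 * (Real.log C + η * Real.log n) := by
  have hn1 : (1 : ℝ) ≤ n := by exact_mod_cast Nat.one_le_iff_ne_zero.2 hn
  have h2 : (2 : ℝ) ^ n.primeFactors.card ≤ C * (n : ℝ) ^ η := by
    have := two_pow_card_primeFactors_le_card_divisors hn
    calc (2 : ℝ) ^ n.primeFactors.card = ((2 ^ n.primeFactors.card : ℕ) : ℝ) := by push_cast; rfl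
      _ ≤ (n.divisors.card : ℝ) := by exact_mod_cast this
      _ ≤ C * (n : ℝ) ^ η := hd n
  have hlog : (n.primeFactors.card : ℝ) * Real.log 2 ≤ Real.log C + η * Real.log n := by
    have hpow : 0 < (2 : ℝ) ^ n.primeFactors.card := by positivity
    have h := Real.log_le_log hpow h2
    rwa [Real.log_pow, Real.log_mul (by positivity) (by positivity), Real.log_rpow (by positivity)]
      at h
  have hlog2 : (1 / 2 : ℝ) < Real.log 2 := by
    have := Real.log_two_gt_d9; linarith
  have hnonneg : 0 ≤ Real.log C + η * Real.log n :=
    add_nonneg (Real.log_nonneg hC) (mul_nonneg hη (Real.log_nonneg hn1))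
  have hω0 : (0 : ℝ) ≤ n.primeFactors.card := Nat.cast_nonneg _
  nlinarith

/-! ### Elliptic-curve inputs: `|Δ_E| = Δ_min`, `N ∣ Δ_min` -/

section EC

variable (W : WeierstrassCurve ℚ) [W.IsElliptic] [W.IsGloballyMinimal]

/-- For a globally minimal elliptic `W/ℚ`: `Δ_min = |Δ(W)|` as real numbers
(`minimalDiscriminantNorm_int_eq_natAbs_minimalDiscriminantInt_holds`, `cast_minimalDiscriminantInt`).
[cite: SilvermanAEC2009, VIII.8] -/
private theorem cast_minimalDiscriminantNorm_eq_abs' :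
    ((W.minimalDiscriminantNorm ℤ : ℕ) : ℝ) = |((W.Δ : ℚ) : ℝ)| := by
  rw [WeierstrassCurve.minimalDiscriminantNorm_int_eq_natAbs_minimalDiscriminantInt_holds W,
    Nat.cast_natAbs, Int.cast_abs, ← WeierstrassCurve.cast_minimalDiscriminantInt W, Rat.cast_intCast]

omit [W.IsGloballyMinimal] in
/-- `N_E ∣ Δ_min` over `ℚ` (`f_p ≤ ord_p Δ_min`; Silverman AEC VIII.11, ATAEC IV.11.1).
[cite: SilvermanAEC2009, VIII.11] -/
private theorem conductorNorm_dvd_minimalDiscriminantNorm' :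
    W.conductorNorm ℤ ∣ W.minimalDiscriminantNorm ℤ :=
  WeierstrassCurve.conductorNorm_dvd_minimalDiscriminantNorm W
    (WeierstrassCurve.finite_setOf_ordMinimalDiscriminant_ne_zero_holds W)

end EC

/-! ### Thm 7.6 (height bound) from (3.4) and Thm 6.1 -/

/-- **Pasten 2024, Thm 7.6 (the Shimura curve approach to `abc`), height half, from (3.4) and
Thm 6.1** — the printed proof (p. 27), formalised over abstract degree functions `δ₁` (for
`δ_{1,N}(E)`) and `δ` (for `δ_{D,M}(E)`). Hypotheses, stated verbatim for those functions:
`h34` = (3.4) *"`h(E) ≤ ½ log δ_{1,N} + 9`"* (§3 p. 13) and `h61` = Thm 6.1, first display,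
*"`log δ_{1,N} ≤ log δ_{D,M} + log(∏_{p∣D} v_p(Δ_E)) + 5.1·ω(D)`"* for every admissible `N = DM`
(p. 20; `v_p(Δ_E) = (W.minimalDiscriminantNorm ℤ).factorization p`, `ω(D) = #D.primeFactors`).
Conclusion: *"Let `ε > 0`. For all elliptic curves `E` of conductor `N ≫_ε 1` [...] and for any
admissible factorization `N = DM` we have [...] `h(E) < (1/2 + ε) log δ_{D,M}(E)`"* (Thm 7.6), with
`h(E) = neronLatticeHeight L` for the Néron lattice of a global minimal model `W`,
`N = W.conductorNorm ℤ`, admissible = (`N = DM`, `D` squarefree with an even number of prime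
factors, `gcd(D, M) = 1`). Proof: module docstring (divisor bound `d(n) ≤ C n^η` in place of the
printed `d(n) < n^{1.07/log log n}`, (3.2) = `pasten2024_log_minimalDiscriminant_le_holds`,
`N ∣ Δ_min`, and `thm76_real_core`).
[cite: PastenShimura2024, Thm 7.6 (proof, p. 27), with (3.2), (3.4) p. 13 and Thm 6.1 p. 20] -/
theorem pasten2024_thm_7_6_height_of_eq_3_4_of_thm_6_1 (δ₁ : WeierstrassCurve ℚ → ℝ)
    (δ : WeierstrassCurve ℚ → ℕ → ℕ → ℝ)
    (h34 : ∀ (W : WeierstrassCurve ℚ) [W.IsElliptic] [W.IsGloballyMinimal] (L : PeriodPair),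
      IsNeronLatticeOf (W.baseChange ℂ) L → neronLatticeHeight L ≤ Real.log (δ₁ W) / 2 + 9)
    (h61 : ∀ (W : WeierstrassCurve ℚ) [W.IsElliptic] [W.IsGloballyMinimal] (D M : ℕ),
      W.conductorNorm ℤ = D * M → Squarefree D → Even D.primeFactors.card → D.Coprime M →
        Real.log (δ₁ W) ≤ Real.log (δ W D M) +
          Real.log (∏ p ∈ D.primeFactors, ((W.minimalDiscriminantNorm ℤ).factorization p : ℝ)) +
          5.1 * D.primeFactors.card) :
    ∀ ε : ℝ, 0 < ε → ∃ N₁ : ℕ,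
      ∀ (W : WeierstrassCurve ℚ) [W.IsElliptic] [W.IsGloballyMinimal] (L : PeriodPair),
        IsNeronLatticeOf (W.baseChange ℂ) L →
        ∀ D M : ℕ, W.conductorNorm ℤ = D * M → Squarefree D → Even D.primeFactors.card →
          D.Coprime M → N₁ ≤ W.conductorNorm ℤ →
            neronLatticeHeight L < (1 / 2 + ε) * Real.log (δ W D M) := by
  intro ε hε
  -- constants
  set θ : ℝ := ε / (1 + 2 * ε) with hθ
  have hθpos : 0 < θ := by positivity
  set η : ℝ := θ / 135 with hη
  have hηpos : 0 < η := by positivity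
  obtain ⟨C, hC1, hC⟩ := Sieve.exists_card_divisors_le_mul_rpow' hηpos
  set c : ℝ := Real.log C with hc
  have hc0 : 0 ≤ c := Real.log_nonneg hC1
  set K : ℝ := 5.6 * c + 89.6 * η + 9 with hK
  have hK0 : 0 ≤ K + 1 := by positivity
  -- `N₁` with `log N₁ ≥ (24/θ)(K+1)`
  refine ⟨⌈Real.exp (24 / θ * (K + 1))⌉₊, fun W _ _ L hL D M hN hD hDe hDM hN₁ ↦ ?_⟩
  have hN0 : W.conductorNorm ℤ ≠ 0 :=
    (WeierstrassCurve.conductorNorm_pos_holds W : 0 < W.conductorNorm ℤ).ne'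
  have hD0 : D ≠ 0 := by rintro rfl; rw [zero_mul] at hN; exact hN0 hN
  have hNreal : (1 : ℝ) ≤ W.conductorNorm ℤ := by exact_mod_cast Nat.one_le_iff_ne_zero.2 hN0
  -- the quantities of `thm76_real_core`
  set Δm : ℕ := W.minimalDiscriminantNorm ℤ with hΔm
  have hΔabs : ((Δm : ℕ) : ℝ) = |((W.Δ : ℚ) : ℝ)| := cast_minimalDiscriminantNorm_eq_abs' W
  have hΔ1 : (1 : ℝ) ≤ Δm := hΔabs ▸ one_le_abs_Δ W
  have hΔ0 : Δm ≠ 0 := by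
    intro h; rw [h, Nat.cast_zero] at hΔ1; exact absurd hΔ1 (by norm_num)
  have hNdvd : W.conductorNorm ℤ ∣ Δm := conductorNorm_dvd_minimalDiscriminantNorm' W
  set h : ℝ := neronLatticeHeight L
  set ℓ : ℝ := Real.log (δ W D M)
  set Λ : ℝ := Real.log Δm with hΛ
  set n : ℝ := Real.log (W.conductorNorm ℤ) with hn
  set X : ℝ := Real.log (∏ p ∈ D.primeFactors, ((Δm.factorization p : ℕ) : ℝ)) with hX
  set w : ℝ := (D.primeFactors.card : ℝ) with hw
  -- (3.4) + Thm 6.1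
  have h1 : h ≤ ℓ / 2 + X / 2 + 2.55 * w + 9 := by
    have a := h34 W L hL
    have b := h61 W D M hN hD hDe hDM
    linarith
  -- (3.2): `Λ = log|Δ_E| ≤ 12 h + 16`
  have h3 : Λ ≤ 12 * h + 16 := by
    have := pasten2024_log_minimalDiscriminant_le_holds W L hL
    rwa [← hΔabs] at this
  -- `N ∣ Δ_min`: `n ≤ Λ`
  have h5 : n ≤ Λ :=
    Real.log_le_log (by positivity) (by exact_mod_cast Nat.le_of_dvd (Nat.pos_of_ne_zero hΔ0) hNdvd)
  -- divisor bound for `∏_{p ∣ D} v_p(Δ)`: `X ≤ c + η Λ`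
  have h2 : X ≤ c + η * Λ := by
    have hsub : D.primeFactors ⊆ Δm.primeFactors :=
      Nat.primeFactors_mono ((Dvd.intro M hN.symm).trans hNdvd) hΔ0
    have hprod : ∏ p ∈ D.primeFactors, Δm.factorization p ≤ Δm.divisors.card :=
      prod_factorization_le_card_divisors hΔ0 hsub
    have hpos : (0 : ℝ) < ∏ p ∈ D.primeFactors, ((Δm.factorization p : ℕ) : ℝ) := by
      refine prod_pos fun p hp ↦ ?_
      have hp' := hsub hp
      exact_mod_cast (Nat.prime_of_mem_primeFactors hp').factorization_pos_of_dvd hΔ0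
        (Nat.dvd_of_mem_primeFactors hp')
    calc X ≤ Real.log (Δm.divisors.card : ℝ) := by
          refine Real.log_le_log hpos ?_
          exact_mod_cast hprod
      _ ≤ Real.log (C * (Δm : ℝ) ^ η) :=
          Real.log_le_log (by exact_mod_cast Finset.card_pos.2 ⟨1, Nat.one_mem_divisors.2 hΔ0⟩) (hC Δm)
      _ = c + η * Λ := by
          rw [Real.log_mul (by positivity) (by positivity), Real.log_rpow (by positivity)]
  -- `ω(D) ≤ ω(N) ≤ 2 (log C + η log N)`
  have h4 : w ≤ 2 * (c + η * n) := by
    have hle : D.primeFactors.card ≤ (W.conductorNorm ℤ).primeFactors.card :=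
      card_le_card (Nat.primeFactors_mono (Dvd.intro M hN.symm) hN0)
    calc w = (D.primeFactors.card : ℝ) := hw
      _ ≤ ((W.conductorNorm ℤ).primeFactors.card : ℝ) := by exact_mod_cast hle
      _ ≤ 2 * (c + η * n) := card_primeFactors_le_of_divisorBound hC1 hηpos.le hC hN0
  -- `N ≥ N₁`: `n ≥ (24/θ)(K+1)`
  have h7 : 24 / θ * (K + 1) ≤ n := by
    have h1' : Real.exp (24 / θ * (K + 1)) ≤ W.conductorNorm ℤ :=
      (Nat.le_ceil _).trans (by exact_mod_cast hN₁)
    have := Real.log_le_log (Real.exp_pos _) h1'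
    rwa [Real.log_exp] at this
  exact thm76_real_core hε hθ hη hc0 hK h1 h2 h3 h4 h5 h7

/-- **Pasten 2024, Thm 1.9 (= Cor 7.8, unconditional) from (3.4), Thm 6.1 and Thm 7.2** — the
printed chain (3.4) + Thm 6.1 ⟹ Thm 7.6, Thm 7.6 + Thm 7.2 ⟹ Thm 7.7 ⟹ Cor 7.8 (pp. 13, 20,
26–27), for abstract degree functions `δ₁` (`δ_{1,N}`) and `δ` (`δ_{D,M}`):
`pasten2024_thm_7_6_height_of_eq_3_4_of_thm_6_1` composed with
`pasten2024_height_lt_of_thm_7_6_of_thm_7_2`. The remaining hypotheses are exactly the deep inputs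
of the paper: (3.4) (classical modular approach, `D = 1`), Thm 6.1 (refined Ribet–Takahashi on
`X_0^D(M)`) and Thm 7.2 (the degree bound via Thm 5.5, Prop 7.1 and the size of the congruence
moduli). [cite: PastenShimura2024, Thm 1.9 via (3.4), Thm 6.1, Thm 7.2, Thm 7.6, Thm 7.7, Cor 7.8] -/
theorem pasten2024_height_lt_of_eq_3_4_of_thm_6_1_of_thm_7_2 (δ₁ : WeierstrassCurve ℚ → ℝ)
    (δ : WeierstrassCurve ℚ → ℕ → ℕ → ℝ)
    (h34 : ∀ (W : WeierstrassCurve ℚ) [W.IsElliptic] [W.IsGloballyMinimal] (L : PeriodPair),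
      IsNeronLatticeOf (W.baseChange ℂ) L → neronLatticeHeight L ≤ Real.log (δ₁ W) / 2 + 9)
    (h61 : ∀ (W : WeierstrassCurve ℚ) [W.IsElliptic] [W.IsGloballyMinimal] (D M : ℕ),
      W.conductorNorm ℤ = D * M → Squarefree D → Even D.primeFactors.card → D.Coprime M →
        Real.log (δ₁ W) ≤ Real.log (δ W D M) +
          Real.log (∏ p ∈ D.primeFactors, ((W.minimalDiscriminantNorm ℤ).factorization p : ℝ)) +
          5.1 * D.primeFactors.card)
    (h72 : ∀ ε : ℝ, 0 < ε → ∃ N₂ : ℕ,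
      ∀ (W : WeierstrassCurve ℚ) [W.IsElliptic],
        ∀ D M : ℕ, W.conductorNorm ℤ = D * M → Squarefree D → Even D.primeFactors.card →
          D.Coprime M → N₂ ≤ W.conductorNorm ℤ →
            Real.log (δ W D M) <
              (1 / 24 + ε) * (Nat.totient D : ℝ) * (M : ℝ) * Real.log (W.conductorNorm ℤ)) :
    pasten2024_height_lt :=
  pasten2024_height_lt_of_thm_7_6_of_thm_7_2 δ
    (pasten2024_thm_7_6_height_of_eq_3_4_of_thm_6_1 δ₁ δ h34 h61) h72

/-! ### The same with arbitrary constants -/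

set_option maxHeartbeats 400000 in
/-- **The bookkeeping of the proof of Thm 7.6 with general constants.** With `θ = ε/(1+2ε)`,
`η = θ/(14 + 48β)`, `K = c/2 + 8η + 2βc + 32βη + α` (`α, β, c ≥ 0`): if
`h ≤ ℓ/2 + X/2 + β w + α`, `X ≤ c + η Λ`, `Λ ≤ 12 h + 16`, `w ≤ 2 (c + η n)`, `n ≤ Λ` and
`n ≥ (24/θ)(K + 1)`, then `h < (1/2 + ε) ℓ`. [folklore] -/
theorem thm76_real_core_general {ε θ η α β c K h ℓ X Λ n w : ℝ} (hε : 0 < ε)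
    (hθ : θ = ε / (1 + 2 * ε)) (hβ : 0 ≤ β) (hη : η = θ / (14 + 48 * β)) (hc : 0 ≤ c)
    (hα : 0 ≤ α) (hK : K = c / 2 + 8 * η + 2 * β * c + 32 * β * η + α)
    (h1 : h ≤ ℓ / 2 + X / 2 + β * w + α) (h2 : X ≤ c + η * Λ) (h3 : Λ ≤ 12 * h + 16)
    (h4 : w ≤ 2 * (c + η * n)) (h5 : n ≤ Λ) (h7 : 24 / θ * (K + 1) ≤ n) :
    h < (1 / 2 + ε) * ℓ := by
  have hθpos : 0 < θ := by rw [hθ]; positivity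
  have hθle : θ ≤ 1 / 2 := by
    rw [hθ, div_le_iff₀ (by positivity)]
    linarith
  have hη0 : 0 ≤ η := by rw [hη]; positivity
  have eη : θ = (14 + 48 * β) * η := by rw [hη]; field_simp
  -- Step A: `h ≤ ℓ/2 + (6 + 24β) η h + K`
  have hA1 : η * Λ ≤ 12 * (η * h) + 16 * η := by
    nlinarith [mul_le_mul_of_nonneg_left h3 hη0]
  have hA2 : η * n ≤ 12 * (η * h) + 16 * η := by
    nlinarith [mul_le_mul_of_nonneg_left (h5.trans h3) hη0]
  have hA3 : β * w ≤ 2 * (β * c) + 2 * (β * (η * n)) := by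
    nlinarith [mul_le_mul_of_nonneg_left h4 hβ]
  have hA4 : β * (η * n) ≤ 12 * (β * (η * h)) + 16 * (β * η) := by
    nlinarith [mul_le_mul_of_nonneg_left hA2 hβ]
  have hA : h ≤ ℓ / 2 + (6 * (η * h) + 24 * (β * (η * h))) + K := by
    rw [hK]; nlinarith [h1, h2, hA1, hA3, hA4]
  -- Step B: largeness of `n` forces `h > 0` and absorbs `K`
  have hK0 : 0 ≤ K := by rw [hK]; positivity
  have hB1 : 24 * (K + 1) ≤ θ * n := by
    have := mul_le_mul_of_nonneg_left h7 hθpos.le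
    have e : θ * (24 / θ * (K + 1)) = 24 * (K + 1) := by field_simp
    linarith
  have hB2 : θ * n ≤ 12 * (θ * h) + 16 * θ := by
    nlinarith [mul_le_mul_of_nonneg_left (h5.trans h3) hθpos.le]
  have hθh : 2 * (K + 1) - 4 / 3 * θ ≤ θ * h := by linarith
  have hh : 0 < h := by
    have hpos : 0 < θ * h := by linarith
    exact pos_of_mul_pos_right hpos hθpos.le
  have hB3 : 6 * (η * h) + 24 * (β * (η * h)) ≤ 1 / 2 * (θ * h) := by
    have e2 : θ * h = 14 * (η * h) + 48 * (β * (η * h)) := by rw [eη]; ring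
    have : 0 ≤ η * h := by positivity
    rw [e2]; linarith
  have hB4 : K ≤ 1 / 2 * (θ * h) - 1 / 3 := by linarith
  have hmain : h - θ * h < ℓ / 2 := by linarith
  -- Step C
  have e : (1 + 2 * ε) * (θ * h) = ε * h := by
    rw [hθ]; field_simp
  have hC1 := mul_lt_mul_of_pos_left hmain (by positivity : (0 : ℝ) < 1 + 2 * ε)
  have hC2 : h + ε * h < ℓ / 2 + ε * ℓ := by nlinarith [hC1, e]
  nlinarith [mul_pos hε hh]

/-- **Thm 7.6 (height half) from (3.4)- and Thm 6.1-type bounds with arbitrary constants.** The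
same statement and proof as `pasten2024_thm_7_6_height_of_eq_3_4_of_thm_6_1`, but with the
printed constants `9` (in (3.4): `h(E) ≤ ½ log δ_{1,N} + 9`) and `5.1`, `0` (in Thm 6.1:
`log δ_{1,N} ≤ log δ_{D,M} + log ∏_{p∣D} v_p(Δ_E) + 5.1 ω(D)`) replaced by arbitrary real constants
`A`, `B`, `B'` (`h ≤ ½ log δ₁ + A`, `log δ₁ ≤ log δ + log ∏ v_p + B ω(D) + B'`), so that any
rendering of `δ_{1,N}` (e.g. the minimal parametrisation degree of `E` itself, `≤ 163 δ_{1,N}` by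
Mazur–Kenku, which shifts the constants by `log 163`) can be plugged in. The conclusion is unchanged:
`h(E) < (1/2 + ε) log δ_{D,M}(E)` for `N ≫_{ε,A,B,B'} 1` and every admissible `N = DM`.
[cite: PastenShimura2024, Thm 7.6 (proof, p. 27)] -/
theorem pasten2024_thm_7_6_height_of_bounds (δ₁ : WeierstrassCurve ℚ → ℝ)
    (δ : WeierstrassCurve ℚ → ℕ → ℕ → ℝ) (A B B' : ℝ)
    (h34 : ∀ (W : WeierstrassCurve ℚ) [W.IsElliptic] [W.IsGloballyMinimal] (L : PeriodPair),
      IsNeronLatticeOf (W.baseChange ℂ) L → neronLatticeHeight L ≤ Real.log (δ₁ W) / 2 + A)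
    (h61 : ∀ (W : WeierstrassCurve ℚ) [W.IsElliptic] [W.IsGloballyMinimal] (D M : ℕ),
      W.conductorNorm ℤ = D * M → Squarefree D → Even D.primeFactors.card → D.Coprime M →
        Real.log (δ₁ W) ≤ Real.log (δ W D M) +
          Real.log (∏ p ∈ D.primeFactors, ((W.minimalDiscriminantNorm ℤ).factorization p : ℝ)) +
          B * D.primeFactors.card + B') :
    ∀ ε : ℝ, 0 < ε → ∃ N₁ : ℕ,
      ∀ (W : WeierstrassCurve ℚ) [W.IsElliptic] [W.IsGloballyMinimal] (L : PeriodPair),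
        IsNeronLatticeOf (W.baseChange ℂ) L →
        ∀ D M : ℕ, W.conductorNorm ℤ = D * M → Squarefree D → Even D.primeFactors.card →
          D.Coprime M → N₁ ≤ W.conductorNorm ℤ →
            neronLatticeHeight L < (1 / 2 + ε) * Real.log (δ W D M) := by
  intro ε hε
  -- constants
  set α : ℝ := max A 0 + max B' 0 / 2 with hαdef
  have hα : 0 ≤ α := by positivity
  set β : ℝ := max B 0 / 2 with hβdef
  have hβ : 0 ≤ β := by positivity
  set θ : ℝ := ε / (1 + 2 * ε) with hθ
  have hθpos : 0 < θ := by positivity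
  set η : ℝ := θ / (14 + 48 * β) with hη
  have hηpos : 0 < η := by positivity
  obtain ⟨C, hC1, hC⟩ := Sieve.exists_card_divisors_le_mul_rpow' hηpos
  set c : ℝ := Real.log C with hc
  have hc0 : 0 ≤ c := Real.log_nonneg hC1
  set K : ℝ := c / 2 + 8 * η + 2 * β * c + 32 * β * η + α with hK
  refine ⟨⌈Real.exp (24 / θ * (K + 1))⌉₊, fun W _ _ L hL D M hN hD hDe hDM hN₁ ↦ ?_⟩
  have hN0 : W.conductorNorm ℤ ≠ 0 :=
    (WeierstrassCurve.conductorNorm_pos_holds W : 0 < W.conductorNorm ℤ).ne'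
  -- the quantities of `thm76_real_core_general`
  set Δm : ℕ := W.minimalDiscriminantNorm ℤ with hΔm
  have hΔabs : ((Δm : ℕ) : ℝ) = |((W.Δ : ℚ) : ℝ)| := cast_minimalDiscriminantNorm_eq_abs' W
  have hΔ1 : (1 : ℝ) ≤ Δm := hΔabs ▸ one_le_abs_Δ W
  have hΔ0 : Δm ≠ 0 := by
    intro h; rw [h, Nat.cast_zero] at hΔ1; exact absurd hΔ1 (by norm_num)
  have hNdvd : W.conductorNorm ℤ ∣ Δm := conductorNorm_dvd_minimalDiscriminantNorm' W
  set h : ℝ := neronLatticeHeight L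
  set ℓ : ℝ := Real.log (δ W D M)
  set Λ : ℝ := Real.log Δm with hΛ
  set n : ℝ := Real.log (W.conductorNorm ℤ) with hn
  set X : ℝ := Real.log (∏ p ∈ D.primeFactors, ((Δm.factorization p : ℕ) : ℝ)) with hX
  set w : ℝ := (D.primeFactors.card : ℝ) with hw
  have hw0 : 0 ≤ w := Nat.cast_nonneg _
  -- (3.4)-type + Thm 6.1-type bounds
  have h1 : h ≤ ℓ / 2 + X / 2 + β * w + α := by
    have a := h34 W L hL
    have b := h61 W D M hN hD hDe hDM
    have hA : A ≤ max A 0 := le_max_left _ _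
    have hB' : B' ≤ max B' 0 := le_max_left _ _
    have hB : B * w ≤ max B 0 * w := mul_le_mul_of_nonneg_right (le_max_left _ _) hw0
    rw [hαdef, hβdef]
    linarith
  -- (3.2): `Λ = log|Δ_E| ≤ 12 h + 16`
  have h3 : Λ ≤ 12 * h + 16 := by
    have := pasten2024_log_minimalDiscriminant_le_holds W L hL
    rwa [← hΔabs] at this
  -- `N ∣ Δ_min`: `n ≤ Λ`
  have h5 : n ≤ Λ :=
    Real.log_le_log (by positivity) (by exact_mod_cast Nat.le_of_dvd (Nat.pos_of_ne_zero hΔ0) hNdvd)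
  -- divisor bound for `∏_{p ∣ D} v_p(Δ)`: `X ≤ c + η Λ`
  have h2 : X ≤ c + η * Λ := by
    have hsub : D.primeFactors ⊆ Δm.primeFactors :=
      Nat.primeFactors_mono ((Dvd.intro M hN.symm).trans hNdvd) hΔ0
    have hprod : ∏ p ∈ D.primeFactors, Δm.factorization p ≤ Δm.divisors.card :=
      prod_factorization_le_card_divisors hΔ0 hsub
    have hpos : (0 : ℝ) < ∏ p ∈ D.primeFactors, ((Δm.factorization p : ℕ) : ℝ) := by
      refine prod_pos fun p hp ↦ ?_
      have hp' := hsub hp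
      exact_mod_cast (Nat.prime_of_mem_primeFactors hp').factorization_pos_of_dvd hΔ0
        (Nat.dvd_of_mem_primeFactors hp')
    calc X ≤ Real.log (Δm.divisors.card : ℝ) := by
          refine Real.log_le_log hpos ?_
          exact_mod_cast hprod
      _ ≤ Real.log (C * (Δm : ℝ) ^ η) :=
          Real.log_le_log (by exact_mod_cast Finset.card_pos.2 ⟨1, Nat.one_mem_divisors.2 hΔ0⟩) (hC Δm)
      _ = c + η * Λ := by
          rw [Real.log_mul (by positivity) (by positivity), Real.log_rpow (by positivity)]
  -- `ω(D) ≤ ω(N) ≤ 2 (log C + η log N)`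
  have h4 : w ≤ 2 * (c + η * n) := by
    have hle : D.primeFactors.card ≤ (W.conductorNorm ℤ).primeFactors.card :=
      card_le_card (Nat.primeFactors_mono (Dvd.intro M hN.symm) hN0)
    calc w = (D.primeFactors.card : ℝ) := hw
      _ ≤ ((W.conductorNorm ℤ).primeFactors.card : ℝ) := by exact_mod_cast hle
      _ ≤ 2 * (c + η * n) := card_primeFactors_le_of_divisorBound hC1 hηpos.le hC hN0
  -- `N ≥ N₁`: `n ≥ (24/θ)(K+1)`
  have h7 : 24 / θ * (K + 1) ≤ n := by
    have h1' : Real.exp (24 / θ * (K + 1)) ≤ W.conductorNorm ℤ :=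
      (Nat.le_ceil _).trans (by exact_mod_cast hN₁)
    have := Real.log_le_log (Real.exp_pos _) h1'
    rwa [Real.log_exp] at this
  exact thm76_real_core_general hε hθ hβ hη hc0 hα hK h1 h2 h3 h4 h5 h7

/-- **Thm 1.9 from (3.4)- and Thm 6.1-type bounds with arbitrary constants and Thm 7.2**:
`pasten2024_thm_7_6_height_of_bounds` composed with `pasten2024_height_lt_of_thm_7_6_of_thm_7_2`.
[cite: PastenShimura2024, Thm 1.9 via (3.4), Thm 6.1, Thm 7.2, Thm 7.6, Thm 7.7, Cor 7.8] -/
theorem pasten2024_height_lt_of_bounds_of_thm_7_2 (δ₁ : WeierstrassCurve ℚ → ℝ)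
    (δ : WeierstrassCurve ℚ → ℕ → ℕ → ℝ) (A B B' : ℝ)
    (h34 : ∀ (W : WeierstrassCurve ℚ) [W.IsElliptic] [W.IsGloballyMinimal] (L : PeriodPair),
      IsNeronLatticeOf (W.baseChange ℂ) L → neronLatticeHeight L ≤ Real.log (δ₁ W) / 2 + A)
    (h61 : ∀ (W : WeierstrassCurve ℚ) [W.IsElliptic] [W.IsGloballyMinimal] (D M : ℕ),
      W.conductorNorm ℤ = D * M → Squarefree D → Even D.primeFactors.card → D.Coprime M →
        Real.log (δ₁ W) ≤ Real.log (δ W D M) +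
          Real.log (∏ p ∈ D.primeFactors, ((W.minimalDiscriminantNorm ℤ).factorization p : ℝ)) +
          B * D.primeFactors.card + B')
    (h72 : ∀ ε : ℝ, 0 < ε → ∃ N₂ : ℕ,
      ∀ (W : WeierstrassCurve ℚ) [W.IsElliptic],
        ∀ D M : ℕ, W.conductorNorm ℤ = D * M → Squarefree D → Even D.primeFactors.card →
          D.Coprime M → N₂ ≤ W.conductorNorm ℤ →
            Real.log (δ W D M) <
              (1 / 24 + ε) * (Nat.totient D : ℝ) * (M : ℝ) * Real.log (W.conductorNorm ℤ)) :
    pasten2024_height_lt :=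
  pasten2024_height_lt_of_thm_7_6_of_thm_7_2 δ
    (pasten2024_thm_7_6_height_of_bounds δ₁ δ A B B' h34 h61) h72

end Literature.NumberTheory.EllipticCurves.ModularForms

end
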